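import Mathlib
import HarnessLib
import Literature.Analysis.PDE.DivFormLiouville
import Literature.Analysis.FunctionSpaces.BMO
import Literature.Analysis.FunctionSpaces.BMOJohnNirenberg
import Literature.Analysis.FunctionSpaces.BMOJohnNirenbergLp
import Summits.NavierStokesRegularity.NavierStokesRegularity.Theorems.PoloidalWindowDoorPoloidalWindowRigidityDivFormLogBMO

/-!
# Route `PoloidalWindowDoor`, crux K2 (stmt-NavierStokesRegularity-19708) — task H5, step M2b: the CROSSOVER estimate
# `(∫_B u^{p₀})(∫_B u^{-p₀}) ≤ C |B|²` for entire weak solutions of `div(a∇u) = 0` (towards `divFormLiouville_holds`)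

Seat ns-poloidal-K2-p3 g2 (`ledger fact claim` #1 on `Literature.Analysis.PDE.divFormLiouville`).  Moser 1961 §5 with
John–Nirenberg 1961 (tree: `Literature.Analysis.FunctionSpaces.john_nirenberg_holds`): from M2a, `log u ∈ BMO(ℝⁿ)` with
`‖log u‖_* ≤ K(n,λ,Λ)`; the John–Nirenberg inequality and the layer-cake formula give exponential integrability
`∫_B e^{p₀|log u − (log u)_B|} ≤ (1 + c₁)|B|` for `p₀ = c₂/(2K)`, whence the crossover of Moser's Harnack proof.

* `lintegral_exp_mul_oscillation_le` — BMO ⇒ exponential integrability on balls (layer cake + John–Nirenberg);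
* `lintegral_rpow_mul_lintegral_rpow_neg_le` — `(∫⁻_B u^{p₀})(∫⁻_B u^{−p₀}) ≤ (1+c₁)² |B|²` for `u = e^f`;
* `exists_crossover` — packaged: `∃ p₀ > 0, C`, depending only on `n, λ, Λ`, such that the crossover holds for every
  coefficient field and every entire `C¹` weak solution `u ≥ 1`, on every ball.

WHAT THIS IS NOT: not yet the Liouville theorem (M3 Moser iterations, M4 Harnack ⇒ Liouville to come); nothing NS-specific.
-/

noncomputable section

open MeasureTheory Set Function Filter Topology Metric
open scoped Matrix ENNReal

-- the summit and its single sub-problem share the name (CONVENTIONS §1), as in every Theorems file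
set_option linter.dupNamespace false

namespace Summit.NavierStokesRegularity.NavierStokesRegularity.Theorems.PoloidalWindowDoorPoloidalWindowRigidityDivFormCrossover

open Summit.NavierStokesRegularity.NavierStokesRegularity.Theorems.PoloidalWindowDoorPoloidalWindowRigidityDivFormLogBMO
open Literature.Analysis.FunctionSpaces

variable {n : ℕ}

/-! ### Exponential integrability from `BMO` (John–Nirenberg + layer cake) -/

/-- `∫₀ˢ p e^{pt} dt = e^{ps} − 1`. -/
theorem intervalIntegral_mul_exp_mul (p s : ℝ) :
    ∫ t in (0 : ℝ)..s, p * Real.exp (p * t) = Real.exp (p * s) - 1 := by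
  have hderiv : ∀ t ∈ uIcc 0 s, HasDerivAt (fun t => Real.exp (p * t)) (p * Real.exp (p * t)) t := by
    intro t _
    have h := ((hasDerivAt_id t).const_mul p).exp
    simpa [mul_comm] using h
  have hint : IntervalIntegrable (fun t => p * Real.exp (p * t)) volume 0 s :=
    (continuous_const.mul (Real.continuous_exp.comp (continuous_const.mul continuous_id))).intervalIntegrable _ _
  rw [intervalIntegral.integral_eq_sub_of_hasDerivAt hderiv hint]
  simp

/-- **Exponential integrability of a `BMO` function on balls.**  If `MemBMO f`, `‖f‖_* ≤ K` with `K > 0`, and `c₁, c₂`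
are John–Nirenberg constants for `f`, then with `p₀ = c₂/(2K)`:
`∫⁻_{B} (e^{p₀ |f − f_B|} − 1) ≤ c₁ |B|` for every ball `B = B(x₀,r)`. -/
theorem lintegral_exp_mul_oscillation_le {f : EuclideanSpace ℝ (Fin n) → ℝ} (hf : Measurable f) {K c₁ c₂ : ℝ}
    (hK : 0 < K) (hc₁ : 0 < c₁) (hc₂ : 0 < c₂) (hfK : eBMOSeminorm f ≤ ENNReal.ofReal K)
    (hJN : ∀ (x₀ : EuclideanSpace ℝ (Fin n)) (r : ℝ), 0 < r → ∀ (t : ℝ), 0 < t →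
      volume {x ∈ ball x₀ r | ENNReal.ofReal t * eBMOSeminorm f < ‖f x - ⨍ z in ball x₀ r, f z‖ₑ} ≤
        ENNReal.ofReal (c₁ * Real.exp (-c₂ * t)) * volume (ball x₀ r))
    (x₀ : EuclideanSpace ℝ (Fin n)) {r : ℝ} (hr : 0 < r) :
    ∫⁻ x in ball x₀ r, ENNReal.ofReal (Real.exp (c₂ / (2 * K) * |f x - ⨍ z in ball x₀ r, f z|) - 1) ≤
      ENNReal.ofReal c₁ * volume (ball x₀ r) := by
  set p₀ : ℝ := c₂ / (2 * K) with hp₀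
  have hp₀pos : 0 < p₀ := by rw [hp₀]; positivity
  set g : EuclideanSpace ℝ (Fin n) → ℝ := fun x => |f x - ⨍ z in ball x₀ r, f z| with hg
  have hg_nn : 0 ≤ᵐ[volume.restrict (ball x₀ r)] g := Eventually.of_forall fun x => abs_nonneg _
  have hg_m : AEMeasurable g (volume.restrict (ball x₀ r)) := ((hf.sub measurable_const).abs).aemeasurable
  -- layer cake with `G(s) = e^{p₀ s} − 1 = ∫₀ˢ p₀ e^{p₀ t} dt`
  have hLC := lintegral_comp_eq_lintegral_meas_lt_mul (volume.restrict (ball x₀ r)) hg_nn hg_m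
    (g := fun t => p₀ * Real.exp (p₀ * t))
    (fun t _ => (continuous_const.mul (Real.continuous_exp.comp (continuous_const.mul continuous_id))).intervalIntegrable
      _ _)
    (Eventually.of_forall fun t => by positivity)
  have hLHS : ∫⁻ x in ball x₀ r, ENNReal.ofReal (Real.exp (p₀ * g x) - 1) =
      ∫⁻ x in ball x₀ r, ENNReal.ofReal (∫ t in (0 : ℝ)..g x, p₀ * Real.exp (p₀ * t)) := by
    refine lintegral_congr fun x => ?_
    rw [intervalIntegral_mul_exp_mul]
  rw [hLHS, hLC]
  -- the John–Nirenberg bound on the level sets, for `t > 0`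
  have hlevel : ∀ t : ℝ, 0 < t →
      (volume.restrict (ball x₀ r)) {x | t < g x} ≤ ENNReal.ofReal (c₁ * Real.exp (-c₂ * (t / K))) * volume (ball x₀ r) := by
    intro t ht
    rw [Measure.restrict_apply' measurableSet_ball]
    refine (measure_mono ?_).trans (hJN x₀ r hr (t / K) (by positivity))
    intro x hx
    refine ⟨hx.2, ?_⟩
    have hx1 : t < g x := hx.1
    have h1 : ENNReal.ofReal (t / K) * eBMOSeminorm f ≤ ENNReal.ofReal t := by
      have h2 : ENNReal.ofReal (t / K) * eBMOSeminorm f ≤ ENNReal.ofReal (t / K) * ENNReal.ofReal K :=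
        mul_le_mul' le_rfl hfK
      have h3 : ENNReal.ofReal (t / K) * ENNReal.ofReal K = ENNReal.ofReal t := by
        rw [← ENNReal.ofReal_mul (by positivity), div_mul_cancel₀ _ hK.ne']
      exact h2.trans_eq h3
    refine lt_of_le_of_lt h1 ?_
    rw [Real.enorm_eq_ofReal_abs]
    exact ENNReal.ofReal_lt_ofReal_iff'.2 ⟨hx1, ht.trans hx1⟩
  -- integrate in `t`
  calc ∫⁻ t in Ioi (0 : ℝ), (volume.restrict (ball x₀ r)) {x | t < g x} * ENNReal.ofReal (p₀ * Real.exp (p₀ * t))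
      ≤ ∫⁻ t in Ioi (0 : ℝ), ENNReal.ofReal (c₁ * Real.exp (-c₂ * (t / K))) * volume (ball x₀ r) *
          ENNReal.ofReal (p₀ * Real.exp (p₀ * t)) := by
        refine setLIntegral_mono' measurableSet_Ioi fun t ht => ?_
        exact mul_le_mul' (hlevel t ht) le_rfl
    _ = ∫⁻ t in Ioi (0 : ℝ), ENNReal.ofReal (t ^ ((1 : ℝ) - 1) * Real.exp (-(p₀ * t))) *
          (ENNReal.ofReal (c₁ * p₀) * volume (ball x₀ r)) := by
        refine setLIntegral_congr_fun measurableSet_Ioi fun t ht => ?_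
        have ht0 : (0 : ℝ) < t := ht
        rw [sub_self, Real.rpow_zero, one_mul]
        -- `c₁ e^{-c₂ t/K} · p₀ e^{p₀ t} = e^{-p₀ t} · (c₁ p₀)` since `c₂/K = 2 p₀`
        have hexp : c₁ * Real.exp (-c₂ * (t / K)) * (p₀ * Real.exp (p₀ * t)) = Real.exp (-(p₀ * t)) * (c₁ * p₀) := by
          have h2 : -c₂ * (t / K) = -(p₀ * t) + -(p₀ * t) := by rw [hp₀]; field_simp; ring
          rw [h2, Real.exp_add]
          have h3 : Real.exp (-(p₀ * t)) * Real.exp (p₀ * t) = 1 := by rw [← Real.exp_add]; simp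
          linear_combination c₁ * p₀ * Real.exp (-(p₀ * t)) * h3
        rw [mul_right_comm, ← ENNReal.ofReal_mul (by positivity), hexp, ENNReal.ofReal_mul (by positivity), mul_assoc]
    _ = ENNReal.ofReal ((1 / p₀) ^ (1 : ℝ) * Real.Gamma 1) * (ENNReal.ofReal (c₁ * p₀) * volume (ball x₀ r)) := by
        rw [lintegral_mul_const' _ _ (by finiteness), lintegral_Ioi_ofReal_rpow_mul_exp_neg_mul one_pos hp₀pos]
    _ = ENNReal.ofReal c₁ * volume (ball x₀ r) := by
        rw [Real.Gamma_one, Real.rpow_one, mul_one, ← mul_assoc, ← ENNReal.ofReal_mul (by positivity)]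
        congr 2
        field_simp


/-- From `∫⁻_B (e^{p₀|f−f_B|} − 1) ≤ c₁|B|` to `∫⁻_B e^{p₀|f−f_B|} ≤ (1 + c₁)|B|`. -/
theorem lintegral_exp_mul_oscillation_le' {f : EuclideanSpace ℝ (Fin n) → ℝ} (hf : Measurable f) {K c₁ c₂ : ℝ}
    (hK : 0 < K) (hc₁ : 0 < c₁) (hc₂ : 0 < c₂) (hfK : eBMOSeminorm f ≤ ENNReal.ofReal K)
    (hJN : ∀ (x₀ : EuclideanSpace ℝ (Fin n)) (r : ℝ), 0 < r → ∀ (t : ℝ), 0 < t →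
      volume {x ∈ ball x₀ r | ENNReal.ofReal t * eBMOSeminorm f < ‖f x - ⨍ z in ball x₀ r, f z‖ₑ} ≤
        ENNReal.ofReal (c₁ * Real.exp (-c₂ * t)) * volume (ball x₀ r))
    (x₀ : EuclideanSpace ℝ (Fin n)) {r : ℝ} (hr : 0 < r) :
    ∫⁻ x in ball x₀ r, ENNReal.ofReal (Real.exp (c₂ / (2 * K) * |f x - ⨍ z in ball x₀ r, f z|)) ≤
      ENNReal.ofReal (1 + c₁) * volume (ball x₀ r) := by
  have h := lintegral_exp_mul_oscillation_le hf hK hc₁ hc₂ hfK hJN x₀ hr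
  have hsplit : ∀ x, ENNReal.ofReal (Real.exp (c₂ / (2 * K) * |f x - ⨍ z in ball x₀ r, f z|)) =
      ENNReal.ofReal (Real.exp (c₂ / (2 * K) * |f x - ⨍ z in ball x₀ r, f z|) - 1) + 1 := by
    intro x
    have h1 : (1 : ℝ) ≤ Real.exp (c₂ / (2 * K) * |f x - ⨍ z in ball x₀ r, f z|) :=
      Real.one_le_exp (by positivity)
    rw [← ENNReal.ofReal_one, ← ENNReal.ofReal_add (by linarith) zero_le_one, sub_add_cancel]
  simp_rw [hsplit]
  rw [lintegral_add_right _ measurable_const, setLIntegral_const, one_mul, ENNReal.ofReal_add zero_le_one hc₁.le,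
    ENNReal.ofReal_one, add_mul, one_mul, add_comm]
  exact add_le_add le_rfl h

/-- **The crossover product bound**: for a measurable `u > 0` with `f = log u` as above,
`(∫⁻_B u^{p₀})(∫⁻_B u^{−p₀}) ≤ (1+c₁)² |B|²`, `p₀ = c₂/(2K)`. -/
theorem lintegral_rpow_mul_lintegral_rpow_neg_le {u : EuclideanSpace ℝ (Fin n) → ℝ} (hum : Measurable u)
    (hupos : ∀ x, 0 < u x) {K c₁ c₂ : ℝ} (hK : 0 < K) (hc₁ : 0 < c₁) (hc₂ : 0 < c₂)
    (hfK : eBMOSeminorm (fun x => Real.log (u x)) ≤ ENNReal.ofReal K)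
    (hJN : ∀ (x₀ : EuclideanSpace ℝ (Fin n)) (r : ℝ), 0 < r → ∀ (t : ℝ), 0 < t →
      volume {x ∈ ball x₀ r | ENNReal.ofReal t * eBMOSeminorm (fun x => Real.log (u x)) <
          ‖Real.log (u x) - ⨍ z in ball x₀ r, Real.log (u z)‖ₑ} ≤
        ENNReal.ofReal (c₁ * Real.exp (-c₂ * t)) * volume (ball x₀ r))
    (x₀ : EuclideanSpace ℝ (Fin n)) {r : ℝ} (hr : 0 < r) :
    (∫⁻ x in ball x₀ r, ENNReal.ofReal (u x ^ (c₂ / (2 * K)))) *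
        (∫⁻ x in ball x₀ r, ENNReal.ofReal (u x ^ (-(c₂ / (2 * K))))) ≤
      ENNReal.ofReal ((1 + c₁) ^ 2) * volume (ball x₀ r) ^ 2 := by
  set p₀ : ℝ := c₂ / (2 * K) with hp₀
  set A : ℝ := ⨍ z in ball x₀ r, Real.log (u z) with hA
  have hE := lintegral_exp_mul_oscillation_le' (Real.measurable_log.comp hum) hK hc₁ hc₂ hfK hJN x₀ hr
  -- pointwise: `u^{±p₀} ≤ e^{±p₀ A} e^{p₀ |log u − A|}`
  have hpt : ∀ (σ : ℝ), σ = 1 ∨ σ = -1 → ∀ x, u x ^ (σ * p₀) ≤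
      Real.exp (σ * p₀ * A) * Real.exp (p₀ * |Real.log (u x) - A|) := by
    intro σ hσ x
    rw [Real.rpow_def_of_pos (hupos x), ← Real.exp_add]
    refine Real.exp_le_exp.2 ?_
    have hp : 0 ≤ p₀ := by rw [hp₀]; positivity
    have key : σ * p₀ * (Real.log (u x) - A) ≤ p₀ * |Real.log (u x) - A| := by
      rcases hσ with h | h
      · rw [h, one_mul]; exact mul_le_mul_of_nonneg_left (le_abs_self _) hp
      · rw [h, neg_one_mul, neg_mul, ← mul_neg]; exact mul_le_mul_of_nonneg_left (neg_le_abs _) hp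
    linarith
  have hbound : ∀ (σ : ℝ), σ = 1 ∨ σ = -1 →
      ∫⁻ x in ball x₀ r, ENNReal.ofReal (u x ^ (σ * p₀)) ≤
        ENNReal.ofReal (Real.exp (σ * p₀ * A)) * (ENNReal.ofReal (1 + c₁) * volume (ball x₀ r)) := by
    intro σ hσ
    calc ∫⁻ x in ball x₀ r, ENNReal.ofReal (u x ^ (σ * p₀))
        ≤ ∫⁻ x in ball x₀ r, ENNReal.ofReal (Real.exp (σ * p₀ * A)) *
            ENNReal.ofReal (Real.exp (p₀ * |Real.log (u x) - A|)) := by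
          refine lintegral_mono fun x => ?_
          rw [← ENNReal.ofReal_mul (Real.exp_pos _).le]
          exact ENNReal.ofReal_le_ofReal (hpt σ hσ x)
      _ = ENNReal.ofReal (Real.exp (σ * p₀ * A)) *
            ∫⁻ x in ball x₀ r, ENNReal.ofReal (Real.exp (p₀ * |Real.log (u x) - A|)) :=
          lintegral_const_mul' _ _ ENNReal.ofReal_ne_top
      _ ≤ ENNReal.ofReal (Real.exp (σ * p₀ * A)) * (ENNReal.ofReal (1 + c₁) * volume (ball x₀ r)) :=
          mul_le_mul' le_rfl hE
  have h1 := hbound 1 (Or.inl rfl)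
  have h2 := hbound (-1) (Or.inr rfl)
  simp only [one_mul] at h1
  simp only [neg_mul, one_mul] at h2
  calc (∫⁻ x in ball x₀ r, ENNReal.ofReal (u x ^ p₀)) * (∫⁻ x in ball x₀ r, ENNReal.ofReal (u x ^ (-p₀)))
      ≤ (ENNReal.ofReal (Real.exp (p₀ * A)) * (ENNReal.ofReal (1 + c₁) * volume (ball x₀ r))) *
          (ENNReal.ofReal (Real.exp (-(p₀ * A))) * (ENNReal.ofReal (1 + c₁) * volume (ball x₀ r))) :=
        mul_le_mul' h1 h2
    _ = ENNReal.ofReal ((1 + c₁) ^ 2) * volume (ball x₀ r) ^ 2 := by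
        have hee : ENNReal.ofReal (Real.exp (p₀ * A)) * ENNReal.ofReal (Real.exp (-(p₀ * A))) = 1 := by
          rw [← ENNReal.ofReal_mul (Real.exp_pos _).le, ← Real.exp_add, add_neg_cancel, Real.exp_zero,
            ENNReal.ofReal_one]
        have hcc : ENNReal.ofReal (1 + c₁) * ENNReal.ofReal (1 + c₁) = ENNReal.ofReal ((1 + c₁) ^ 2) := by
          rw [← ENNReal.ofReal_mul (by positivity), sq]
        calc ENNReal.ofReal (Real.exp (p₀ * A)) * (ENNReal.ofReal (1 + c₁) * volume (ball x₀ r)) *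
              (ENNReal.ofReal (Real.exp (-(p₀ * A))) * (ENNReal.ofReal (1 + c₁) * volume (ball x₀ r)))
            = (ENNReal.ofReal (Real.exp (p₀ * A)) * ENNReal.ofReal (Real.exp (-(p₀ * A)))) *
                ((ENNReal.ofReal (1 + c₁) * ENNReal.ofReal (1 + c₁)) * volume (ball x₀ r) ^ 2) := by ring
          _ = ENNReal.ofReal ((1 + c₁) ^ 2) * volume (ball x₀ r) ^ 2 := by rw [hee, hcc, one_mul]

/-! ### The packaged crossover estimate -/

/-- **CROSSOVER (Moser 1961 §5 via John–Nirenberg).**  There are `p₀ > 0` and `C ≥ 0`, depending only on `n`, `λ`, `Λ`,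
such that for every coefficient field `a` (measurable, symmetric, `λ|ξ|² ≤ ξ·aξ`, `|aᵢⱼ| ≤ Λ`) and every `C¹` weak solution
`u ≥ 1` of `div(a∇u) = 0` on all of `ℝⁿ` (weak formulation of `Literature.Analysis.PDE.divFormLiouville`), on every ball:
`(∫⁻_{B(x₀,r)} u^{p₀}) · (∫⁻_{B(x₀,r)} u^{−p₀}) ≤ C |B(x₀,r)|²`. -/
theorem exists_crossover (n : ℕ) {lam : ℝ} (hlam : 0 < lam) (Λ : ℝ) :
    ∃ p₀ C : ℝ, 0 < p₀ ∧ 0 ≤ C ∧ ∀ (a : EuclideanSpace ℝ (Fin n) → Matrix (Fin n) (Fin n) ℝ),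
      (∀ i j, Measurable fun y => a y i j) → (∀ y, (a y).IsSymm) →
      (∀ y (ξ : Fin n → ℝ), lam * (ξ ⬝ᵥ ξ) ≤ ξ ⬝ᵥ (a y *ᵥ ξ)) → (∀ y i j, |a y i j| ≤ Λ) →
      ∀ (u : EuclideanSpace ℝ (Fin n) → ℝ), ContDiff ℝ 1 u → (∀ y, 1 ≤ u y) →
        (∀ η : EuclideanSpace ℝ (Fin n) → ℝ, ContDiff ℝ 1 η → HasCompactSupport η →
          ∫ y, ∑ i, ∑ j, a y i j * fderiv ℝ u y (EuclideanSpace.single i 1) *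
            fderiv ℝ η y (EuclideanSpace.single j 1) = 0) →
        ∀ (x₀ : EuclideanSpace ℝ (Fin n)) (r : ℝ), 0 < r →
          (∫⁻ x in ball x₀ r, ENNReal.ofReal (u x ^ p₀)) * (∫⁻ x in ball x₀ r, ENNReal.ofReal (u x ^ (-p₀))) ≤
            ENNReal.ofReal C * volume (ball x₀ r) ^ 2 := by
  obtain ⟨K, hK0, hK⟩ := exists_eBMOSeminorm_log_le n hlam Λ
  obtain ⟨c₁, c₂, hc₁, hc₂, hJN⟩ := john_nirenberg_holds (EuclideanSpace ℝ (Fin n)) ℝ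
  set K' : ℝ := max K 1 with hK'
  have hK'pos : 0 < K' := lt_of_lt_of_le one_pos (le_max_right _ _)
  refine ⟨c₂ / (2 * K'), (1 + c₁) ^ 2, by positivity, by positivity,
    fun a hmeas hsymm hell hbd u hu hu1 hweak x₀ r hr => ?_⟩
  obtain ⟨hbmo, hmem⟩ := hK a hmeas hsymm hell hbd u hu hu1 hweak
  have hbmo' : eBMOSeminorm (fun x => Real.log (u x)) ≤ ENNReal.ofReal K' :=
    hbmo.trans (ENNReal.ofReal_le_ofReal (le_max_left _ _))
  have hupos : ∀ x, 0 < u x := fun x => lt_of_lt_of_le one_pos (hu1 x)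
  exact lintegral_rpow_mul_lintegral_rpow_neg_le hu.continuous.measurable hupos hK'pos hc₁ hc₂ hbmo'
    (fun x₀ r hr t ht => hJN _ hmem x₀ r hr t ht) x₀ hr

end Summit.NavierStokesRegularity.NavierStokesRegularity.Theorems.PoloidalWindowDoorPoloidalWindowRigidityDivFormCrossover

end
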